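import Mathlib
import HarnessLib

/-!
# One-dimensional profiles for the positive-time Whitney-type synthesis (tool for the registered stub
# `stub_positiveTimeSynthesisCollar` of LINES 2/3, ym-idea-11, cruxes 23138 / 22956)

Pure real analysis, Mathlib only.  We record:

* `exists_bound_iteratedFDeriv_of_hasCompactSupport`: a smooth compactly supported real function has every derivative
  uniformly bounded;
* the UNIT PARTITION PROFILE `gProfile x = smoothTransition x - smoothTransition (x - 1)`: smooth, values in `[0,1]`,
  support in `[0,2]`, integer translates telescope (`sum_gProfile_window`);
* uniform bounds for all derivatives of `Real.smoothTransition` (`exists_bound_iteratedFDeriv_smoothTransition`);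
* the DYADIC LAYER PROFILES `layerCum j t = smoothTransition (2^(j+2) t - 2)` and `layer j` (`layer 0 = layerCum 0`,
  `layer (j+1) = layerCum (j+1) - layerCum j`): nonnegative, telescoping (`sum_layer_range`), `layer j t ≠ 0` forces
  `2 < 2^(j+2) t` (and `2^(j+2) t < 6` when `1 ≤ j`), and `layerCum J t = 1` once `3 ≤ 2^(J+2) t`.

These are the vertical (time) and horizontal (lattice) building blocks of the partition of unity of the open half-space
`{z₀ > 0}` used to prove `StubPosTimeSynthCollarP` (skeletons «FloorInheritance» v5 on 23138 / «MarkovFloorInheritance» v3 on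
22956).  HONEST FRAMING: calculus infrastructure; no stub / crux / rung / summit is proved here; the Yang–Mills mass gap is NOT
proved.  Cell `ym-idea-1`, width seat `ym-line-sfw-p2-w4` g21 (free hands). [folklore]
-/

set_option autoImplicit false

noncomputable section

open scoped BigOperators ContDiff
open Set

namespace Summit.QuantumFields.YangMills.Theorems.RPOnsetFloorPosTimeSynth

/-! ## §1 Uniform derivative bounds for compactly supported smooth functions -/

/-- A smooth compactly supported real function on a normed space has every iterated derivative uniformly bounded
(the derivative is continuous and compactly supported). [folklore] -/
theorem exists_bound_iteratedFDeriv_of_hasCompactSupport {E : Type*} [NormedAddCommGroup E] [NormedSpace ℝ E]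
    {f : E → ℝ} (hf : ContDiff ℝ ∞ f) (hc : HasCompactSupport f) (n : ℕ) :
    ∃ D : ℝ, 0 ≤ D ∧ ∀ x, ‖iteratedFDeriv ℝ n f x‖ ≤ D := by
  have hg : Continuous fun x => ‖iteratedFDeriv ℝ n f x‖ :=
    (hf.continuous_iteratedFDeriv (mod_cast le_top)).norm
  obtain ⟨x₀, hx₀⟩ := hg.exists_forall_ge_of_hasCompactSupport (hc.iteratedFDeriv n).norm
  exact ⟨_, norm_nonneg _, hx₀⟩

/-! ## §2 The unit partition profile `g = ST - ST (· - 1)` -/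

/-- The unit partition profile `g x = smoothTransition x - smoothTransition (x - 1)`: a smooth bump with values in `[0,1]`,
support in `[0,2]`, whose integer translates form a partition of unity on `ℝ`. [folklore] -/
def gProfile (x : ℝ) : ℝ := Real.smoothTransition x - Real.smoothTransition (x - 1)

/-- `g` is smooth. [folklore] -/
theorem gProfile_contDiff : ContDiff ℝ ∞ gProfile :=
  Real.smoothTransition.contDiff.sub (Real.smoothTransition.contDiff.comp (contDiff_id.sub contDiff_const))

/-- `g x = 0` for `x ≤ 0`. [folklore] -/
theorem gProfile_eq_zero_of_nonpos {x : ℝ} (hx : x ≤ 0) : gProfile x = 0 := by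
  simp [gProfile, Real.smoothTransition.zero_of_nonpos hx,
    Real.smoothTransition.zero_of_nonpos (by linarith : x - 1 ≤ 0)]

/-- `g x = 0` for `2 ≤ x`. [folklore] -/
theorem gProfile_eq_zero_of_two_le {x : ℝ} (hx : 2 ≤ x) : gProfile x = 0 := by
  simp [gProfile, Real.smoothTransition.one_of_one_le (by linarith : (1 : ℝ) ≤ x),
    Real.smoothTransition.one_of_one_le (by linarith : (1 : ℝ) ≤ x - 1)]

/-- `0 ≤ g`. [folklore] -/
theorem gProfile_nonneg (x : ℝ) : 0 ≤ gProfile x :=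
  sub_nonneg.2 (Real.smoothTransition.monotone (by linarith))

/-- `g ≤ 1`. [folklore] -/
theorem gProfile_le_one (x : ℝ) : gProfile x ≤ 1 := by
  have h1 := Real.smoothTransition.le_one x
  have h2 := Real.smoothTransition.nonneg (x - 1)
  unfold gProfile; linarith

/-- If `g x ≠ 0` then `0 < x < 2`. [folklore] -/
theorem pos_and_lt_two_of_gProfile_ne_zero {x : ℝ} (hx : gProfile x ≠ 0) : 0 < x ∧ x < 2 := by
  by_contra h
  rw [not_and_or, not_lt, not_lt] at h
  rcases h with h | h
  · exact hx (gProfile_eq_zero_of_nonpos h)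
  · exact hx (gProfile_eq_zero_of_two_le h)

/-- The support of `g` lies in `[0,2]`. [folklore] -/
theorem support_gProfile_subset : Function.support gProfile ⊆ Icc 0 2 := fun _ hx =>
  let h := pos_and_lt_two_of_gProfile_ne_zero (Function.mem_support.1 hx)
  ⟨h.1.le, h.2.le⟩

/-- `g` has compact support. [folklore] -/
theorem hasCompactSupport_gProfile : HasCompactSupport gProfile :=
  HasCompactSupport.of_support_subset_isCompact isCompact_Icc support_gProfile_subset

/-- Telescoping of the integer translates of `g`: `∑_{k < N} g (y - k) = ST y - ST (y - N)`. [folklore] -/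
theorem sum_gProfile_range (y : ℝ) (N : ℕ) :
    ∑ k ∈ Finset.range N, gProfile (y - k) = Real.smoothTransition y - Real.smoothTransition (y - N) := by
  induction N with
  | zero => simp
  | succ N ih =>
    rw [Finset.sum_range_succ, ih]
    simp only [gProfile, Nat.cast_succ]
    ring_nf

/-- The two integer translates of `g` that can be non-zero at `x` sum to `1`: with `a = ⌊x⌋ - 1`,
`g (x - a) + g (x - (a + 1)) = 1`. [folklore] -/
theorem gProfile_window_sum (x : ℝ) :
    gProfile (x - ((⌊x⌋ : ℤ) - 1 : ℤ)) + gProfile (x - (⌊x⌋ : ℤ)) = 1 := by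
  have h1 : (1 : ℝ) ≤ x - ((⌊x⌋ : ℤ) - 1 : ℤ) := by
    push_cast; linarith [Int.floor_le x]
  have h2 : x - (⌊x⌋ : ℤ) - 1 ≤ 0 := by linarith [Int.lt_floor_add_one x]
  have e1 : gProfile (x - ((⌊x⌋ : ℤ) - 1 : ℤ)) = 1 - Real.smoothTransition (x - (⌊x⌋ : ℤ)) := by
    unfold gProfile
    rw [Real.smoothTransition.one_of_one_le h1]
    push_cast; ring_nf
  have e2 : gProfile (x - (⌊x⌋ : ℤ)) = Real.smoothTransition (x - (⌊x⌋ : ℤ)) := by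
    unfold gProfile
    rw [Real.smoothTransition.zero_of_nonpos h2, sub_zero]
  rw [e1, e2]; ring

/-- An integer translate `g (x - n)` is non-zero only for `n ∈ {⌊x⌋ - 1, ⌊x⌋}`. [folklore] -/
theorem gProfile_translate_eq_zero {x : ℝ} {n : ℤ} (hn : n ∉ Finset.Icc (⌊x⌋ - 1) ⌊x⌋) :
    gProfile (x - n) = 0 := by
  rw [Finset.mem_Icc, not_and_or, not_le, not_le] at hn
  rcases hn with hn | hn
  · -- `n ≤ ⌊x⌋ - 2`, so `x - n ≥ 2`
    have hn' : n ≤ ⌊x⌋ - 2 := by omega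
    have : (n : ℝ) ≤ (⌊x⌋ : ℝ) - 2 := by exact_mod_cast hn'
    exact gProfile_eq_zero_of_two_le (by linarith [Int.floor_le x])
  · -- `⌊x⌋ + 1 ≤ n`, so `x - n ≤ 0`
    have hn' : ⌊x⌋ + 1 ≤ n := by omega
    have : (⌊x⌋ : ℝ) + 1 ≤ (n : ℝ) := by exact_mod_cast hn'
    exact gProfile_eq_zero_of_nonpos (by linarith [Int.lt_floor_add_one x])

/-- The integer translates of `g` form a partition of unity: summed over the window `{⌊x⌋ - 1, ⌊x⌋}` they give `1`.
[folklore] -/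
theorem sum_gProfile_window (x : ℝ) : ∑ n ∈ Finset.Icc (⌊x⌋ - 1) ⌊x⌋, gProfile (x - n) = 1 := by
  have hne : (⌊x⌋ - 1 : ℤ) ≠ ⌊x⌋ := by omega
  have hIcc : Finset.Icc (⌊x⌋ - 1) ⌊x⌋ = {⌊x⌋ - 1, ⌊x⌋} := by
    ext n; simp only [Finset.mem_Icc, Finset.mem_insert, Finset.mem_singleton]; omega
  rw [hIcc, Finset.sum_pair hne]
  exact_mod_cast gProfile_window_sum x

/-! ## §3 All derivatives of `Real.smoothTransition` are bounded -/

/-- The iterated derivatives of `smoothTransition` vanish on the open negative half-line. [folklore] -/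
theorem iteratedFDeriv_smoothTransition_of_neg (n : ℕ) {x : ℝ} (hx : x < 0) :
    iteratedFDeriv ℝ n Real.smoothTransition x = 0 := by
  have h : (Real.smoothTransition : ℝ → ℝ) =ᶠ[nhds x] fun _ => (0 : ℝ) := by
    filter_upwards [Iio_mem_nhds hx] with y hy
    exact Real.smoothTransition.zero_of_nonpos (le_of_lt hy)
  rw [(h.iteratedFDeriv ℝ n).eq_of_nhds]
  simp

/-- The iterated derivatives of positive order of `smoothTransition` vanish on `(1, ∞)`. [folklore] -/
theorem iteratedFDeriv_smoothTransition_of_one_lt {n : ℕ} (hn : n ≠ 0) {x : ℝ} (hx : 1 < x) :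
    iteratedFDeriv ℝ n Real.smoothTransition x = 0 := by
  have h : (Real.smoothTransition : ℝ → ℝ) =ᶠ[nhds x] fun _ => (1 : ℝ) := by
    filter_upwards [Ioi_mem_nhds hx] with y hy
    exact Real.smoothTransition.one_of_one_le (le_of_lt hy)
  rw [(h.iteratedFDeriv ℝ n).eq_of_nhds, iteratedFDeriv_const_of_ne hn]
  simp

/-- The recursion `D^n ST (y) = D^n g (y) + D^n ST (y - 1)` (from `ST = g + ST (· - 1)`). [folklore] -/
theorem iteratedFDeriv_smoothTransition_eq_add (n : ℕ) (y : ℝ) :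
    iteratedFDeriv ℝ n Real.smoothTransition y =
      iteratedFDeriv ℝ n gProfile y + iteratedFDeriv ℝ n Real.smoothTransition (y - 1) := by
  have hST : ContDiff ℝ n Real.smoothTransition := Real.smoothTransition.contDiff
  have hST1 : ContDiff ℝ n (fun y : ℝ => Real.smoothTransition (y - 1)) :=
    hST.comp (contDiff_id.sub contDiff_const)
  have hg : gProfile = fun y => Real.smoothTransition y - Real.smoothTransition (y - 1) := rfl
  rw [hg, fun_iteratedFDeriv_sub_apply hST.contDiffAt hST1.contDiffAt,
    iteratedFDeriv_comp_sub n (1 : ℝ) y]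
  abel

/-- **All derivatives of `Real.smoothTransition` are uniformly bounded.** [folklore] -/
theorem exists_bound_iteratedFDeriv_smoothTransition (n : ℕ) :
    ∃ D : ℝ, 0 ≤ D ∧ ∀ x, ‖iteratedFDeriv ℝ n Real.smoothTransition x‖ ≤ D := by
  obtain ⟨D, hD0, hD⟩ :=
    exists_bound_iteratedFDeriv_of_hasCompactSupport gProfile_contDiff hasCompactSupport_gProfile n
  refine ⟨2 * D + 1, by positivity, fun x => ?_⟩
  rcases Nat.eq_zero_or_pos n with rfl | hn
  · rw [norm_iteratedFDeriv_zero, Real.norm_eq_abs, abs_of_nonneg (Real.smoothTransition.nonneg x)]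
    linarith [Real.smoothTransition.le_one x]
  · have aux : ∀ y : ℝ, y < 1 → ‖iteratedFDeriv ℝ n Real.smoothTransition y‖ ≤ D := by
      intro y hy
      rw [iteratedFDeriv_smoothTransition_eq_add n y,
        iteratedFDeriv_smoothTransition_of_neg n (by linarith : y - 1 < 0), add_zero]
      exact hD y
    by_cases hx : 1 < x
    · rw [iteratedFDeriv_smoothTransition_of_one_lt hn.ne' hx, norm_zero]; positivity
    · push Not at hx
      rw [iteratedFDeriv_smoothTransition_eq_add n x]
      calc ‖iteratedFDeriv ℝ n gProfile x + iteratedFDeriv ℝ n Real.smoothTransition (x - 1)‖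
          ≤ ‖iteratedFDeriv ℝ n gProfile x‖ + ‖iteratedFDeriv ℝ n Real.smoothTransition (x - 1)‖ :=
            norm_add_le _ _
        _ ≤ D + D := add_le_add (hD x) (aux (x - 1) (by linarith))
        _ ≤ 2 * D + 1 := by linarith

/-! ## §4 Dyadic layer profiles -/

/-- Cumulative layer profile `Ψ_j (t) = smoothTransition (2^(j+2) t - 2)`: `0` for `t ≤ 2^(-(j+1))`, `1` for
`t ≥ 3 · 2^(-(j+2))`. [folklore] -/
def layerCum (j : ℕ) (t : ℝ) : ℝ := Real.smoothTransition (2 ^ (j + 2) * t - 2)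

/-- Layer profiles: `layer 0 = Ψ_0` (the TOP layer, `t ≳ 1/2`) and `layer (j+1) = Ψ_(j+1) - Ψ_j` (the dyadic layer
`t ≈ 2^(-(j+1))`). [folklore] -/
def layer : ℕ → ℝ → ℝ
  | 0 => layerCum 0
  | j + 1 => fun t => layerCum (j + 1) t - layerCum j t

/-- `Ψ_j` is smooth. [folklore] -/
theorem layerCum_contDiff (j : ℕ) : ContDiff ℝ ∞ (layerCum j) :=
  Real.smoothTransition.contDiff.comp ((contDiff_const.mul contDiff_id).sub contDiff_const)

/-- `layer j` is smooth. [folklore] -/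
theorem layer_contDiff : ∀ j : ℕ, ContDiff ℝ ∞ (layer j)
  | 0 => layerCum_contDiff 0
  | j + 1 => (layerCum_contDiff (j + 1)).sub (layerCum_contDiff j)

/-- `Ψ_j t = 0` when `2^(j+2) t ≤ 2`. [folklore] -/
theorem layerCum_eq_zero {j : ℕ} {t : ℝ} (h : 2 ^ (j + 2) * t ≤ 2) : layerCum j t = 0 :=
  Real.smoothTransition.zero_of_nonpos (by linarith)

/-- `Ψ_j t = 1` when `3 ≤ 2^(j+2) t`. [folklore] -/
theorem layerCum_eq_one {j : ℕ} {t : ℝ} (h : 3 ≤ 2 ^ (j + 2) * t) : layerCum j t = 1 :=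
  Real.smoothTransition.one_of_one_le (by linarith)

/-- `Ψ_j` is pointwise monotone in `j` on `t`: `Ψ_j t ≤ Ψ_(j+1) t`. [folklore] -/
theorem layerCum_le_succ (j : ℕ) (t : ℝ) : layerCum j t ≤ layerCum (j + 1) t := by
  unfold layerCum
  by_cases ht : 0 ≤ t
  · apply Real.smoothTransition.monotone
    have : (2 : ℝ) ^ (j + 2) * t ≤ 2 ^ (j + 1 + 2) * t := by
      apply mul_le_mul_of_nonneg_right _ ht
      exact pow_le_pow_right₀ (by norm_num) (by omega)
    linarith
  · push Not at ht
    have h1 : (2 : ℝ) ^ (j + 2) * t - 2 ≤ 0 := by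
      have : (2 : ℝ) ^ (j + 2) * t ≤ 0 := mul_nonpos_of_nonneg_of_nonpos (by positivity) ht.le
      linarith
    have h2 : (2 : ℝ) ^ (j + 1 + 2) * t - 2 ≤ 0 := by
      have : (2 : ℝ) ^ (j + 1 + 2) * t ≤ 0 := mul_nonpos_of_nonneg_of_nonpos (by positivity) ht.le
      linarith
    rw [Real.smoothTransition.zero_of_nonpos h1, Real.smoothTransition.zero_of_nonpos h2]

/-- `0 ≤ layer j`. [folklore] -/
theorem layer_nonneg : ∀ (j : ℕ) (t : ℝ), 0 ≤ layer j t
  | 0, _ => Real.smoothTransition.nonneg _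
  | j + 1, t => sub_nonneg.2 (layerCum_le_succ j t)

/-- Telescoping: `∑_{j ≤ J} layer j t = Ψ_J t`. [folklore] -/
theorem sum_layer_range (J : ℕ) (t : ℝ) : ∑ j ∈ Finset.range (J + 1), layer j t = layerCum J t := by
  induction J with
  | zero => simp [layer]
  | succ J ih => rw [Finset.sum_range_succ, ih]; simp [layer]

/-- `layer j t ≠ 0` forces `2 < 2^(j+2) t` (so `t > 2^(-(j+1)) > 0`). [folklore] -/
theorem two_lt_of_layer_ne_zero : ∀ {j : ℕ} {t : ℝ}, layer j t ≠ 0 → 2 < 2 ^ (j + 2) * t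
  | 0, t, h => by
    by_contra hle; push Not at hle
    exact h (layerCum_eq_zero hle)
  | j + 1, t, h => by
    by_contra hle; push Not at hle
    have h1 : layerCum (j + 1) t = 0 := layerCum_eq_zero hle
    have h0 : layerCum j t = 0 := by
      apply le_antisymm _ (Real.smoothTransition.nonneg _)
      calc layerCum j t ≤ layerCum (j + 1) t := layerCum_le_succ j t
        _ = 0 := h1
    exact h (by simp [layer, h1, h0])

/-- For `j ≥ 1`, `layer j t ≠ 0` forces `2^(j+2) t < 6` (so `t < 3 · 2^(-(j+1))`). [folklore] -/
theorem lt_six_of_layer_ne_zero : ∀ {j : ℕ} {t : ℝ}, layer j t ≠ 0 → 1 ≤ j → 2 ^ (j + 2) * t < 6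
  | 0, _, _, hj => absurd hj (by norm_num)
  | j + 1, t, h, _ => by
    by_contra hle; push Not at hle
    have h0 : layerCum j t = 1 := by
      apply layerCum_eq_one
      have : (2 : ℝ) ^ (j + 1 + 2) * t = 2 * (2 ^ (j + 2) * t) := by ring
      linarith
    have h1 : layerCum (j + 1) t = 1 := by
      apply le_antisymm (Real.smoothTransition.le_one _)
      calc (1 : ℝ) = layerCum j t := h0.symm
        _ ≤ layerCum (j + 1) t := layerCum_le_succ j t
    exact h (by simp [layer, h1, h0])

/-- `layer j t = 0` for `t ≤ 0`. [folklore] -/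
theorem layer_eq_zero_of_nonpos (j : ℕ) {t : ℝ} (ht : t ≤ 0) : layer j t = 0 := by
  by_contra h
  have := two_lt_of_layer_ne_zero h
  have : (2 : ℝ) ^ (j + 2) * t ≤ 0 := mul_nonpos_of_nonneg_of_nonpos (by positivity) ht
  linarith

/-- Above the layer scale everything is `1`: if `0 < t` there is `J` with `Ψ_J' t = 1` for all `J' ≥ J`. [folklore] -/
theorem exists_layerCum_eq_one {t : ℝ} (ht : 0 < t) : ∃ J : ℕ, ∀ J' : ℕ, J ≤ J' → layerCum J' t = 1 := by
  obtain ⟨J, hJ⟩ := exists_nat_gt (3 / t)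
  refine ⟨J, fun J' hJ' => layerCum_eq_one ?_⟩
  have h2 : (J' : ℝ) + 2 ≤ 2 ^ (J' + 2) := by
    have := Nat.lt_two_pow_self (n := J' + 2)
    exact_mod_cast this.le
  have hJ'' : (3 : ℝ) / t < J' + 2 := by
    have : (J : ℝ) ≤ J' := by exact_mod_cast hJ'
    linarith
  rw [div_lt_iff₀ ht] at hJ''
  nlinarith

/-- Beyond the top of the range the layers vanish: if `1 ≤ j` and `6 ≤ 2^(j+2) t` then `layer j t = 0`. [folklore] -/
theorem layer_eq_zero_of_le {j : ℕ} {t : ℝ} (hj : 1 ≤ j) (h : 6 ≤ 2 ^ (j + 2) * t) : layer j t = 0 := by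
  by_contra hne
  exact absurd (lt_six_of_layer_ne_zero hne hj) (not_lt.2 h)

end Summit.QuantumFields.YangMills.Theorems.RPOnsetFloorPosTimeSynth

end
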